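import Summits.QuantumFields.GaugeBoot.TiltedSiteRPHolonomy
import HarnessLib

/-!
# Site-hyperplane reflection positivity of the Wilson measure of a periodic lattice
(gauge-boot, L3(τ) part 4)

HONEST FRAMING (cell `pub-gaugeboot`, page 1 of every file): the venture produces certified bounds
on lattice expectations at stated coupling, gauge group, dimension and torus size; NOT a mass gap,
NOT a continuum limit, NOT a string tension; NOT Yang–Mills-summit-bearing (barriers
`FixedCouplingUltralocality`, `PerturbativeInvisibility`).

**Theorem (`IsSiteFrame.integral_conj_mul_nonneg`).** Let the periodic lattice `(A, e)` carry a
site frame `IsSiteFrame e k θ P h` (`TiltedSiteRPGeometry.lean`: reflection `θ` in the lattice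
hyperplane `h = 0` orthogonal to the axis `k`, height `h : A →+ ZMod (2P)`, `P ≥ 2`, both layers
`h = 0`, `h = P` pointwise fixed). For a compact second countable `G`, a continuous representation
`ρ` and `β ≥ 0` the Wilson measure `gibbs ρ e β` is REFLECTION POSITIVE for the Osterwalder–Seiler
reflection `Θ = configReflect e k θ` (`(ΘU)(x, l) = U(θx, l)`, `(ΘU)(x, k) = U(θx - e_k, k)⁻¹`):
`0 ≤ ∫ conj F(ΘU) · F(U) dμ_β(U)` for every bounded measurable `F` depending only on the links of the
closed half `{0 ≤ h ≤ P}`; the corresponding RP blocks are positive semidefinite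
(`sum_mul_conj_integral_nonneg`), and `S(ΘU) = S(U)`, `∫ F(ΘU) dμ_β = ∫ F dμ_β`.

Proof (Fröhlich–Israel–Lieb–Simon 1978 Thm. 2.1, reflection through sites; Osterwalder–Seiler 1978
§2): no plaquette is cut — `∑_p Re tr ρ(U_p) = A(U) + A(ΘU) + M(U)`, since
`Re tr ρ((ΘU)_p) = Re tr ρ(U_{plaqReflect p})` (for a plaquette with a `k`-side the reflected
holonomy is `a⁻¹ U_{p'}⁻¹ a`, `a` the lowered `k`-link: conjugation and inversion do not change
`Re tr ρ`); hence `e^{β ∑} conj F(ΘU) F(U) = g(U) conj g(ΘU)`, `g = F e^{β(A + M/2)}` a function of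
the positive and mirror links, and the tree's core lemma with a shared block
`LatticeRP.integral_splice_mul_conj_comp_of_shared_nonneg` applies: `Θ` preserves the product Haar
measure (relabelling of the links composed with the inversion of the `k`-link variables, Haar
measure of a compact group being inversion invariant), fixes the mirror links and reads the
positive links off links outside the closed half.

References: J. Fröhlich, R. Israel, E. H. Lieb, B. Simon, Comm. Math. Phys. 62 (1978) 1, Thm. 2.1;
K. Osterwalder, E. Seiler, Ann. Phys. 110 (1978) 440, §2; E. Seiler, LNP 159 (1982); M. Lüscher,
Comm. Math. Phys. 54 (1977) 283 and P. Menotti, A. Pelissetto, Comm. Math. Phys. 113 (1987) 369, §2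
(site reflections for lattice gauge theories).
-/

noncomputable section

open MeasureTheory Complex
open scoped ComplexOrder ComplexConjugate
open Literature.MathematicalPhysics.QuantumFieldTheory (haarProbability LatticeRP.splice
  LatticeRP.splice_eq_piecewise LatticeRP.integral_splice_mul_conj_comp_of_shared_nonneg)
open Literature.RepresentationTheory.CompactGroups

namespace Summit.QuantumFields.GaugeBoot

namespace TiltedRP

namespace IsSiteFrame

variable {A : Type*} [AddCommGroup A] [Fintype A] {d : ℕ}
variable {e : Fin d → A} {k : Fin d} {θ : A →+ A} {P : ℕ} {h : A →+ ZMod (2 * P)}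
variable (hF : IsSiteFrame e k θ P h)
variable {N : ℕ} {G : Type*} [Group G] [TopologicalSpace G] [IsTopologicalGroup G] [CompactSpace G]
  [MeasurableSpace G] [BorelSpace G] [SecondCountableTopology G]
variable (ρ : G →* Matrix (Fin N) (Fin N) ℂ)
include hF

/-! ## The blocks and the pointwise identity -/

omit [Group G] [TopologicalSpace G] [IsTopologicalGroup G] [CompactSpace G] [MeasurableSpace G]
  [BorelSpace G] [SecondCountableTopology G] hF in
/-- Two configurations agreeing on the positive and mirror links agree on the closed half. -/
theorem eq_on_half_of_eq_on_blocks [DecidableEq A] (hF' : IsSiteFrame e k θ P h) {U V : Config A d G}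
    (hUV : ∀ l ∈ ((IsTiltedFrame.posBlock e k k h ∪ ∅ ∪ IsTiltedFrame.mirrorBlock k k h :
      Finset (Link A d)) : Set (Link A d)), U l = V l) : ∀ l, IsHalfLink e P h l → U l = V l := by
  intro l hl
  apply hUV
  rw [Finset.union_empty, Finset.coe_union, Set.mem_union, Finset.mem_coe, Finset.mem_coe,
    IsTiltedFrame.mem_posBlock, IsTiltedFrame.mem_mirrorBlock]
  exact (hF'.isHalfLink_iff_pos_or_mirror l).1 hl

omit [TopologicalSpace G] [IsTopologicalGroup G] [CompactSpace G] [MeasurableSpace G] [BorelSpace G]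
  [SecondCountableTopology G] in
/-- The reflection fixes the mirror links. -/
theorem configReflect_apply_of_mem_mirrorBlock (U : Config A d G) (l : Link A d)
    (hl : l ∈ IsTiltedFrame.mirrorBlock k k h) : configReflect e k θ U l = U l := by
  obtain ⟨x, m⟩ := l
  have hm := IsTiltedFrame.mem_mirrorBlock.1 hl
  rw [configReflect_other e k θ U x hm.2.1, hF.map_of_isLayer hm.1]

omit [TopologicalSpace G] [IsTopologicalGroup G] [CompactSpace G] [MeasurableSpace G] [BorelSpace G]
  [SecondCountableTopology G] in
/-- The reflected value of a positive link is read off a link outside the positive block. -/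
theorem dependsOn_configReflect_apply [DecidableEq A] (l : Link A d)
    (hl : l ∈ IsTiltedFrame.posBlock e k k h ∪ ∅) :
    DependsOn (fun U : Config A d G => configReflect e k θ U l)
      (((IsTiltedFrame.posBlock e k k h)ᶜ : Finset (Link A d)) : Set (Link A d)) := by
  intro U V hUV
  rw [Finset.union_empty] at hl
  have hout : siteLinkMap e k θ l ∈ (((IsTiltedFrame.posBlock e k k h)ᶜ : Finset (Link A d)) :
      Set (Link A d)) := by
    rw [Finset.coe_compl, Set.mem_compl_iff, Finset.mem_coe, IsTiltedFrame.mem_posBlock]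
    exact fun hp => hF.not_isHalfLink_siteLinkMap (IsTiltedFrame.mem_posBlock.1 hl) hp.1
  have hval := hUV _ hout
  simp only [configReflect, hval]

open scoped Classical in
omit hF in
/-- The observable `g = F · exp(β (A + M/2))`. -/
def gObs (e : Fin d → A) (k : Fin d) (h : A →+ ZMod (2 * P)) (β : ℝ) (F : Config A d G → ℂ)
    (U : Config A d G) : ℂ :=
  F U * (Real.exp (β * (∑ p ∈ Finset.univ.filter (IsSitePosPlaq k P h), plaqObs ρ e p U +
    (∑ p ∈ Finset.univ.filter (IsSiteMirrorPlaq k P h), plaqObs ρ e p U) / 2)) : ℂ)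

open scoped Classical in
omit [MeasurableSpace G] [BorelSpace G] [SecondCountableTopology G] in
/-- **The pointwise identity**: `e^{β ∑_p Re tr ρ(U_p)} conj F(ΘU) F(U) = g(U) conj g(ΘU)`. -/
theorem weight_mul_eq (hρ : Continuous ρ) (β : ℝ) (F : Config A d G → ℂ) (U : Config A d G) :
    (Real.exp (β * ∑ p, plaqObs ρ e p U) : ℂ) * (conj (F (configReflect e k θ U)) * F U) =
      gObs ρ e k h β F U * conj (gObs ρ e k h β F (configReflect e k θ U)) := by
  rw [gObs, gObs, hF.sum_mirror_configReflect ρ hρ, hF.sum_plaqObs_split ρ hρ]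
  set A1 := ∑ p ∈ Finset.univ.filter (IsSitePosPlaq k P h), plaqObs ρ e p U
  set A2 := ∑ p ∈ Finset.univ.filter (IsSitePosPlaq k P h), plaqObs ρ e p (configReflect e k θ U)
  set M1 := ∑ p ∈ Finset.univ.filter (IsSiteMirrorPlaq k P h), plaqObs ρ e p U
  simp only [map_mul, Complex.conj_ofReal]
  rw [show β * (A1 + A2 + M1) = β * (A1 + M1 / 2) + β * (A2 + M1 / 2) by ring, Real.exp_add]
  push_cast
  ring

open scoped Classical in
omit [CompactSpace G] hF in
/-- The observable `g` is measurable. -/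
theorem measurable_gObs (hρ : Continuous ρ) (β : ℝ) {F : Config A d G → ℂ} (hFm : Measurable F) :
    Measurable (gObs ρ e k h β F) := by
  unfold gObs
  refine hFm.mul (Complex.measurable_ofReal.comp (Measurable.exp (Measurable.const_mul ?_ β)))
  exact ((continuous_finsetSum _ fun p _ => continuous_plaqObs ρ hρ e p).measurable).add
    (((continuous_finsetSum _ fun p _ => continuous_plaqObs ρ hρ e p).measurable).div_const _)

open scoped Classical in
omit [MeasurableSpace G] [BorelSpace G] [SecondCountableTopology G] hF in
/-- The observable `g` is bounded. -/
theorem norm_gObs_le (hρ : Continuous ρ) {β : ℝ} (hβ : 0 ≤ β) {F : Config A d G → ℂ} {CF : ℝ}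
    (hFb : ∀ U, ‖F U‖ ≤ CF) (U : Config A d G) :
    ‖gObs ρ e k h β F U‖ ≤ |CF| * Real.exp (β * (2 * (N * Fintype.card (Plaq A d)))) := by
  rw [gObs, norm_mul, Complex.norm_real, Real.norm_eq_abs, abs_of_pos (Real.exp_pos _)]
  refine mul_le_mul ((hFb _).trans (le_abs_self _)) ?_ (Real.exp_pos _).le (abs_nonneg _)
  refine Real.exp_le_exp.2 (mul_le_mul_of_nonneg_left ?_ hβ)
  have h1 := abs_sum_plaqObs_le ρ hρ e (Finset.univ.filter (IsSitePosPlaq k P h)) U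
  have h2 := abs_sum_plaqObs_le ρ hρ e (Finset.univ.filter (IsSiteMirrorPlaq k P h)) U
  have c1 : ((Finset.univ.filter (IsSitePosPlaq k P h)).card : ℝ) ≤ Fintype.card (Plaq A d) := by
    exact_mod_cast Finset.card_filter_le _ _
  have c2 : ((Finset.univ.filter (IsSiteMirrorPlaq k P h)).card : ℝ) ≤ Fintype.card (Plaq A d) := by
    exact_mod_cast Finset.card_filter_le _ _
  have hN : (0 : ℝ) ≤ N := Nat.cast_nonneg _
  rw [abs_le] at h1 h2
  nlinarith

open scoped Classical in
omit [TopologicalSpace G] [IsTopologicalGroup G] [CompactSpace G] [MeasurableSpace G] [BorelSpace G]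
  [SecondCountableTopology G] in
/-- The observable `g` depends only on the positive and mirror links. -/
theorem dependsOn_gObs [DecidableEq A] (β : ℝ) {F : Config A d G → ℂ} (hFo : IsHalfObservable e P h F) :
    DependsOn (gObs ρ e k h β F) ((IsTiltedFrame.posBlock e k k h ∪ ∅ ∪
      IsTiltedFrame.mirrorBlock k k h : Finset (Link A d)) : Set (Link A d)) := by
  intro U V hUV
  have hUV' := eq_on_half_of_eq_on_blocks hF hUV
  have hA : ∑ p ∈ Finset.univ.filter (IsSitePosPlaq k P h), plaqObs ρ e p U =
      ∑ p ∈ Finset.univ.filter (IsSitePosPlaq k P h), plaqObs ρ e p V :=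
    Finset.sum_congr rfl fun p hp => by
      obtain ⟨h1, h2, h3, h4⟩ := hF.isHalfLink_of_isSitePosPlaq (Finset.mem_filter.1 hp).2
      exact IsTiltedFrame.plaqObs_congr ρ p (hUV' _ h1) (hUV' _ h2) (hUV' _ h3) (hUV' _ h4)
  have hM : ∑ p ∈ Finset.univ.filter (IsSiteMirrorPlaq k P h), plaqObs ρ e p U =
      ∑ p ∈ Finset.univ.filter (IsSiteMirrorPlaq k P h), plaqObs ρ e p V :=
    Finset.sum_congr rfl fun p hp => by
      obtain ⟨h1, h2, h3, h4⟩ := hF.isMirrorLink_of_isSiteMirrorPlaq (Finset.mem_filter.1 hp).2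
      exact IsTiltedFrame.plaqObs_congr ρ p (hUV' _ (hF.isHalfLink_of_isMirrorLink h1))
        (hUV' _ (hF.isHalfLink_of_isMirrorLink h2)) (hUV' _ (hF.isHalfLink_of_isMirrorLink h3))
        (hUV' _ (hF.isHalfLink_of_isMirrorLink h4))
  simp only [gObs, hFo U V hUV', hA, hM]

/-! ## Reflection positivity -/

open scoped Classical in
/-- **Reflection positivity of the plaquette weight** (`β ≥ 0`, `F` bounded measurable on the
closed half): `0 ≤ ∫ e^{β ∑_p Re tr ρ(U_p)} conj F(ΘU) F(U) ∏ dU`. -/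
theorem integral_exp_sum_mul_nonneg (hρ : Continuous ρ) {β : ℝ} (hβ : 0 ≤ β)
    {F : Config A d G → ℂ} (hFm : Measurable F) {CF : ℝ} (hFb : ∀ U, ‖F U‖ ≤ CF)
    (hFo : IsHalfObservable e P h F) :
    0 ≤ ∫ U, (Real.exp (β * ∑ p, plaqObs ρ e p U) : ℂ) * (conj (F (configReflect e k θ U)) * F U)
      ∂(productHaar A d G) := by
  classical
  haveI : IsProbabilityMeasure (haarProbability G) :=
    CompactGroup.isProbabilityMeasure_haarMeasure_top
  simp_rw [hF.weight_mul_eq ρ hρ β F]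
  have key := LatticeRP.integral_splice_mul_conj_comp_of_shared_nonneg (haarProbability G)
    (IsTiltedFrame.mirrorBlock k k h) (IsTiltedFrame.posBlock e k k h) ∅ (configReflect e k θ)
    hF.measurePreserving_configReflect
    (fun U l hl => hF.configReflect_apply_of_mem_mirrorBlock U l hl)
    (fun l hl => hF.dependsOn_configReflect_apply l hl) IsTiltedFrame.disjoint_mirrorBlock_posBlock
    (Finset.disjoint_empty_right _) (Φ := gObs ρ e k h β F) (measurable_gObs ρ hρ β hFm)
    (norm_gObs_le ρ hρ hβ hFb) (hF.dependsOn_gObs ρ β hFo)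
  simp only [LatticeRP.splice_eq_piecewise, Finset.piecewise_empty] at key
  unfold productHaar
  rwa [integral_fun_fst (fun U : Config A d G => gObs ρ e k h β F U *
      conj (gObs ρ e k h β F (configReflect e k θ U))), probReal_univ, one_smul] at key

/-- Reflection positivity of the Boltzmann weight. -/
theorem integral_boltzmann_mul_nonneg (hρ : Continuous ρ) {β : ℝ} (hβ : 0 ≤ β)
    {F : Config A d G → ℂ} (hFm : Measurable F) {CF : ℝ} (hFb : ∀ U, ‖F U‖ ≤ CF)
    (hFo : IsHalfObservable e P h F) :
    0 ≤ ∫ U, (Real.exp (-β * wilsonAction ρ e U) : ℂ) * (conj (F (configReflect e k θ U)) * F U)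
      ∂(productHaar A d G) := by
  have hsplit : ∀ U : Config A d G, (Real.exp (-β * wilsonAction ρ e U) : ℂ) =
      (Real.exp (-β * (N * Fintype.card (Plaq A d))) : ℂ) *
        (Real.exp (β * ∑ p, plaqObs ρ e p U) : ℂ) := fun U => by
    rw [← Complex.ofReal_mul, ← Real.exp_add, wilsonAction_eq]
    congr 2
    ring
  simp_rw [hsplit, mul_assoc]
  rw [integral_const_mul]
  exact mul_nonneg (Complex.zero_le_real.2 (Real.exp_pos _).le)
    (hF.integral_exp_sum_mul_nonneg ρ hρ hβ hFm hFb hFo)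

/-- **Site-hyperplane reflection positivity of the Wilson measure of a periodic lattice with a site
frame**: for a compact second countable `G`, continuous `ρ`, `β ≥ 0` and every bounded measurable
observable `F` of the closed half `{0 ≤ h ≤ P}`, `0 ≤ ∫ conj F(ΘU) F(U) dμ_β(U)`. -/
theorem integral_conj_mul_nonneg (hρ : Continuous ρ) {β : ℝ} (hβ : 0 ≤ β)
    (F : Config A d G → ℂ) (hFm : Measurable F) (hFb : ∃ C : ℝ, ∀ U, ‖F U‖ ≤ C)
    (hFo : IsHalfObservable e P h F) :
    0 ≤ ∫ U, conj (F (configReflect e k θ U)) * F U ∂(gibbs ρ e β) := by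
  obtain ⟨CF, hFb⟩ := hFb
  have hZ := normaliser_pos (A := A) (G := G) ρ hρ e β
  rw [integral_gibbs]
  simp_rw [Complex.real_smul, Complex.ofReal_div, div_eq_mul_inv, mul_comm (Complex.ofReal _)
    ((_ : ℂ)⁻¹), mul_assoc]
  rw [integral_const_mul]
  refine mul_nonneg ?_ (hF.integral_boltzmann_mul_nonneg ρ hρ hβ hFm hFb hFo)
  rw [← Complex.ofReal_inv]
  exact Complex.zero_le_real.2 (inv_nonneg.2 hZ.le)

/-- **The site RP blocks are positive semidefinite**: for bounded measurable half-space observables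
`F_1, …, F_n` and `c ∈ ℂ^n`, `0 ≤ ∑_{a,b} conj c_a · c_b · ∫ conj(F_a(ΘU)) F_b(U) dμ_β`. -/
theorem sum_mul_conj_integral_nonneg (hρ : Continuous ρ) {β : ℝ} (hβ : 0 ≤ β) {n : ℕ}
    (F : Fin n → Config A d G → ℂ) (hFm : ∀ a, Measurable (F a))
    (hFb : ∀ a, ∃ C : ℝ, ∀ U, ‖F a U‖ ≤ C) (hFo : ∀ a, IsHalfObservable e P h (F a)) (c : Fin n → ℂ) :
    0 ≤ ∑ a, ∑ b, conj (c a) * c b *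
      ∫ U, conj (F a (configReflect e k θ U)) * F b U ∂(gibbs ρ e β) := by
  haveI := isProbabilityMeasure_gibbs (A := A) (G := G) ρ hρ e β
  set H : Config A d G → ℂ := fun U => ∑ b, c b * F b U with hH
  have hHm : Measurable H := Finset.measurable_sum _ fun b _ => (hFm b).const_mul _
  choose C hC using hFb
  have hHb : ∃ K : ℝ, ∀ U, ‖H U‖ ≤ K := ⟨∑ b, ‖c b‖ * C b, fun U =>
    (norm_sum_le _ _).trans (Finset.sum_le_sum fun b _ => by
      rw [norm_mul]; exact mul_le_mul_of_nonneg_left (hC b U) (norm_nonneg _))⟩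
  have hHo : IsHalfObservable e P h H := fun U V hUV => by
    simp only [hH]
    exact Finset.sum_congr rfl fun b _ => by rw [hFo b U V hUV]
  have key := hF.integral_conj_mul_nonneg ρ hρ hβ H hHm hHb hHo
  have hint : ∀ a b, Integrable (fun U => conj (F a (configReflect e k θ U)) * F b U) (gibbs ρ e β) :=
    fun a b => Integrable.of_bound
      (((Complex.continuous_conj.measurable.comp ((hFm a).comp measurable_configReflect)).mul
        (hFm b)).aestronglyMeasurable) (C a * C b) (ae_of_all _ fun U => by
        rw [norm_mul, Complex.norm_conj]
        exact mul_le_mul (hC a _) (hC b U) (norm_nonneg _) ((norm_nonneg (F a U)).trans (hC a U)))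
  have hexp : ∫ U, conj (H (configReflect e k θ U)) * H U ∂(gibbs ρ e β) =
      ∑ a, ∑ b, conj (c a) * c b *
        ∫ U, conj (F a (configReflect e k θ U)) * F b U ∂(gibbs ρ e β) := by
    have h1 : ∀ U, conj (H (configReflect e k θ U)) * H U =
        ∑ a, ∑ b, conj (c a) * c b * (conj (F a (configReflect e k θ U)) * F b U) := fun U => by
      simp only [hH, map_sum, map_mul]
      rw [Finset.sum_mul_sum]
      exact Finset.sum_congr rfl fun a _ => Finset.sum_congr rfl fun b _ => by ring
    simp_rw [h1]
    rw [integral_finsetSum _ fun a _ => integrable_finsetSum _ fun b _ => (hint a b).const_mul _]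
    refine Finset.sum_congr rfl fun a _ => ?_
    rw [integral_finsetSum _ fun b _ => (hint a b).const_mul _]
    exact Finset.sum_congr rfl fun b _ => integral_const_mul _ _
  rwa [hexp] at key

/-- **Reflection invariance of the Wilson measure**: `∫ F(ΘU) dμ_β = ∫ F dμ_β` (measurable real `F`,
every real `β`). -/
theorem integral_comp_configReflect_gibbs (hρ : Continuous ρ) (β : ℝ) {F : Config A d G → ℝ}
    (hFm : Measurable F) :
    ∫ U, F (configReflect e k θ U) ∂(gibbs ρ e β) = ∫ U, F U ∂(gibbs ρ e β) := by
  rw [integral_gibbs, integral_gibbs]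
  set Z := ∫ U, Real.exp (-β * wilsonAction ρ e U) ∂(productHaar A d G)
  have h1 : ∀ U : Config A d G, (Real.exp (-β * wilsonAction ρ e U) / Z) • F (configReflect e k θ U) =
      (fun V : Config A d G => (Real.exp (-β * wilsonAction ρ e V) / Z) • F V)
        (configReflect e k θ U) := by
    intro U
    simp only [hF.wilsonAction_configReflect ρ hρ]
  have hm : Measurable fun V : Config A d G => (Real.exp (-β * wilsonAction ρ e V) / Z) • F V :=
    (((continuous_boltzmann ρ hρ e β).measurable).div_const _).smul hFm
  simp_rw [h1]
  rw [← integral_map hF.measurePreserving_configReflect.measurable.aemeasurable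
    hm.aestronglyMeasurable, hF.measurePreserving_configReflect.map_eq]

end IsSiteFrame

end TiltedRP

end Summit.QuantumFields.GaugeBoot
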